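import Summits.CriticalPhenomena.PercolationContinuityZ3.Theorems.PercNearOneGluingNoHeavyPcintNawChainZ5C10Defs
import HarnessLib

/-!
# PCINT lane, kernel reduced-state B2c (chain) certificate `Z5C10` (d = 5, memory τ = 10, kc = 4, 798 state classes): row checks 1 (rows [0, 400))

Cell `prim-pcint`, seat `prim-pcint-1` (gen 5); memo `run/shared/lean/prim/pcint/INTERVAL-PLAN.md` §16 ("checker for the reduced-state
automata"; chain bookkeeping REDUCTIONS §B2c).  Does NOT build on p205010.  Data for `NawK.le_siteCriticalProb_of_checkRowsC` (`…PcintNawChainMemKernelCert`):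
`p = 12660/100000`, `q̄ = 98656/100000` (`q̄^10·100000^10 ≥ (100000-12660)·100000^9`), `λ = 99999/100000`; Collatz–Wielandt weights (scale 10⁹) from a
power iteration, exact off-line max row ratio 0.9996577169 < λ.  Generated by gen5/gen_lean.py (pcint-1 folder); the kernel re-checks every row.
-/

namespace Summit.CriticalPhenomena.PercolationContinuityZ3.Theorems.Pcint.NawChainZ5C10

set_option maxHeartbeats 0 in
/-- Rows `[0, 100)` pass the check. [folklore] -/
theorem chk_0 : WinK.allRange (NawK.checkRowC 10 4 5 798 12660 98656 100000 99999 100000 NawChainZ5C10.syms NawChainZ5C10.tree) 0 100 = true :=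
  WinK.allRange_of_allRangeB (fuel := 8) (lo := 0) (len := 100) (by decide +kernel)

set_option maxHeartbeats 0 in
/-- Rows `[100, 200)` pass the check. [folklore] -/
theorem chk_100 : WinK.allRange (NawK.checkRowC 10 4 5 798 12660 98656 100000 99999 100000 NawChainZ5C10.syms NawChainZ5C10.tree) 100 200 = true :=
  WinK.allRange_of_allRangeB (fuel := 8) (lo := 100) (len := 100) (by decide +kernel)

set_option maxHeartbeats 0 in
/-- Rows `[200, 300)` pass the check. [folklore] -/
theorem chk_200 : WinK.allRange (NawK.checkRowC 10 4 5 798 12660 98656 100000 99999 100000 NawChainZ5C10.syms NawChainZ5C10.tree) 200 300 = true :=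
  WinK.allRange_of_allRangeB (fuel := 8) (lo := 200) (len := 100) (by decide +kernel)

set_option maxHeartbeats 0 in
/-- Rows `[300, 400)` pass the check. [folklore] -/
theorem chk_300 : WinK.allRange (NawK.checkRowC 10 4 5 798 12660 98656 100000 99999 100000 NawChainZ5C10.syms NawChainZ5C10.tree) 300 400 = true :=
  WinK.allRange_of_allRangeB (fuel := 8) (lo := 300) (len := 100) (by decide +kernel)

/-- Rows `[0, 400)` pass the check. [folklore] -/
theorem file_1 : WinK.allRange (NawK.checkRowC 10 4 5 798 12660 98656 100000 99999 100000 NawChainZ5C10.syms NawChainZ5C10.tree) 0 400 = true := (WinK.allRange_split (WinK.allRange_split (WinK.allRange_split chk_0 chk_100) chk_200) chk_300)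

end Summit.CriticalPhenomena.PercolationContinuityZ3.Theorems.Pcint.NawChainZ5C10
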